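import Summits.CriticalPhenomena.PercolationContinuityZ3.Theorems.Transplant.FKConnectivityAllQPat3Gluing
import HarnessLib

/-!
# Connectivity correlation inequalities for `φ_{w,q}`, every `q > 0` — REACHABILITY AND PATTERNS across a MARK-FREE two-point
# attachment (the combinatorial half of the one-sided two-sum law, census g26 §4.5 / census g39 §3)

Proof file (`--supports stmt-CriticalPhenomena-4575`), census lineage (gen 40) of LANE 2's FK sub-programme; builds on p205010
(kernel theorem, internal audit signed; external expert review pending).  No definitions, no named facts, no sorries; standard axioms.

SETTING.  Host edges `E₁` on the vertex set `V₁`, piece edges `E₂` on `V₂`, glued along two vertices only (`V₁ ∩ V₂ ⊆ {u, v}`);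
the piece is MARK-FREE: the points read (`a, b`, or the three marks `x, y, s`) lie on the host side — off `V₂` or at `u`/`v`.
* `FK.reachable_union_free` — two host points are joined in `γ₁ ∪ γ₂` iff they are joined in `γ₁`, or joined in `γ₁` to the two
  ends of an open `u ↔ v` passage through the piece (walk splitting at the separator `{u, v, b}`, `GZGluing.walk_split`, as in
  S1's `FK.reachable_union_par_third` and g36's `FK.reachable_union_marks`).
* `FK.pat3_union_free_congr` — hence the host pattern `pat3 (γ₁ ∪ γ₂) x y s` only sees the BIT `1{u ↔ v in γ₂}`: two pieces
  agreeing on the bit give the same pattern; in particular (`FK.pat3_union_free_of_reach` / `FK.pat3_union_free_of_not_reach`)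
  the piece may be replaced by the open VIRTUAL EDGE `uv` when the bit is set and deleted when it is not.
The sibling `…Pat3SlotLaw.lean` adds the level bookkeeping and derives the one-sided two-sum law for `FK.lev2C` / `FK.SPGoodC`.
[cite: Grimmett2006, §1.4 eq. (1.20) (p. 15); §3.8 (pp. 61–62)]
-/

namespace Summit.CriticalPhenomena.PercolationContinuityZ3.Theorems

namespace FK

open SimpleGraph Literature.Probability.LatticeModels Literature.Probability.Percolation
open scoped Classical

variable {V : Type*}

/-! ### Reachability across a mark-free two-point attachment -/

section Reach

variable {E₁ E₂ : Finset (Sym2 V)} {V₁ V₂ : Set V} {u v : V}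

/-- **Host points across a mark-free `{u, v}`-attachment**: for host configurations `γ₁ ⊆ E₁` (on `V₁`) and piece configurations
`γ₂ ⊆ E₂` (on `V₂`, `V₁ ∩ V₂ ⊆ {u, v}`) and two points `a, b` off the piece's interior, `a ↔ b` in `γ₁ ∪ γ₂` iff `a ↔ b` in `γ₁`,
or `a ↔ u`, `v ↔ b` in `γ₁` and `u ↔ v` in `γ₂`, or the same with `u, v` exchanged. [folklore] -/
theorem reachable_union_free (h₁ : ∀ e ∈ (↑E₁ : Set (Sym2 V)), ∀ z ∈ e, z ∈ V₁)
    (h₂ : ∀ e ∈ (↑E₂ : Set (Sym2 V)), ∀ z ∈ e, z ∈ V₂) (hS : V₁ ∩ V₂ ⊆ {u, v}) {a b : V}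
    (ha : a ∈ V₂ → a = u ∨ a = v) (hb : b ∈ V₂ → b = u ∨ b = v)
    {γ₁ γ₂ : Finset (Sym2 V)} (g₁ : γ₁ ⊆ E₁) (g₂ : γ₂ ⊆ E₂) :
    (openGraph (↑(γ₁ ∪ γ₂) : BondConfig V)).Reachable a b ↔
      (openGraph (↑γ₁ : BondConfig V)).Reachable a b ∨
        ((openGraph (↑γ₁ : BondConfig V)).Reachable a u ∧ (openGraph (↑γ₂ : BondConfig V)).Reachable u v ∧
            (openGraph (↑γ₁ : BondConfig V)).Reachable v b) ∨
          ((openGraph (↑γ₁ : BondConfig V)).Reachable a v ∧ (openGraph (↑γ₂ : BondConfig V)).Reachable u v ∧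
            (openGraph (↑γ₁ : BondConfig V)).Reachable u b) := by
  have hω₁ : (↑γ₁ : Set (Sym2 V)) ⊆ ↑E₁ := Finset.coe_subset.2 g₁
  have hω₂ : (↑γ₂ : Set (Sym2 V)) ⊆ ↑E₂ := Finset.coe_subset.2 g₂
  have l₁ : ∀ {p q : V}, (openGraph (↑γ₁ : BondConfig V)).Reachable p q →
      (openGraph (↑(γ₁ ∪ γ₂) : BondConfig V)).Reachable p q := fun h => by
    rw [Finset.coe_union]; exact GZGluing.reachable_union_of_side (Or.inl h)
  have l₂ : ∀ {p q : V}, (openGraph (↑γ₂ : BondConfig V)).Reachable p q →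
      (openGraph (↑(γ₁ ∪ γ₂) : BondConfig V)).Reachable p q := fun h => by
    rw [Finset.coe_union]; exact GZGluing.reachable_union_of_side (Or.inr h)
  refine ⟨fun h => ?_, ?_⟩
  · rw [Finset.coe_union] at h
    obtain ⟨p⟩ := h
    have hS' : V₁ ∩ V₂ ⊆ ({u, v, b} : Set V) := fun z hz => by
      rcases hS hz with h | h
      · exact Or.inl h
      · exact Or.inr (Or.inl h)
    obtain ⟨s', hs'S, hside, hchain⟩ := GZGluing.walk_split h₁ h₂ hS' hω₁ hω₂ p (by simp)
    -- two DISTINCT points of `{u, v, b}` joined inside `γ₂` are `u` and `v`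
    have key2 : ∀ p' q' : V, p' ∈ ({u, v, b} : Set V) → q' ∈ ({u, v, b} : Set V) →
        (openGraph (↑γ₂ : BondConfig V)).Reachable p' q' → p' ≠ q' →
        (openGraph (↑γ₂ : BondConfig V)).Reachable u v ∧ (p' = u ∧ q' = v ∨ p' = v ∧ q' = u) := by
      intro p' q' hp' hq' hr hne
      have hp'2 : p' ∈ V₂ := GZGluing.mem_of_reachable_ne h₂ hω₂ hr hne
      have hq'2 : q' ∈ V₂ := GZGluing.mem_of_reachable_ne h₂ hω₂ hr.symm hne.symm
      have hp'uv : p' = u ∨ p' = v := by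
        rcases hp' with h | h | h
        · exact Or.inl h
        · exact Or.inr h
        · rw [Set.mem_singleton_iff] at h; rw [h] at hp'2 ⊢; exact hb hp'2
      have hq'uv : q' = u ∨ q' = v := by
        rcases hq' with h | h | h
        · exact Or.inl h
        · exact Or.inr h
        · rw [Set.mem_singleton_iff] at h; rw [h] at hq'2 ⊢; exact hb hq'2
      rcases hp'uv with hp | hp <;> rcases hq'uv with hq | hq
      · exact absurd (hp.trans hq.symm) hne
      · rw [hp, hq] at hr; exact ⟨hr, Or.inl ⟨hp, hq⟩⟩
      · rw [hp, hq] at hr; exact ⟨hr.symm, Or.inr ⟨hp, hq⟩⟩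
      · exact absurd (hp.trans hq.symm) hne
    -- the invariant along the chain of hops
    have hA : ∀ p' q', p' ∈ ({z | (openGraph (↑γ₁ : BondConfig V)).Reachable a z ∨
          ((openGraph (↑γ₁ : BondConfig V)).Reachable a u ∧ (openGraph (↑γ₂ : BondConfig V)).Reachable u v ∧
            (openGraph (↑γ₁ : BondConfig V)).Reachable v z) ∨
          ((openGraph (↑γ₁ : BondConfig V)).Reachable a v ∧ (openGraph (↑γ₂ : BondConfig V)).Reachable u v ∧
            (openGraph (↑γ₁ : BondConfig V)).Reachable u z)} : Set V) →
        (p' ∈ ({u, v, b} : Set V) ∧ q' ∈ ({u, v, b} : Set V) ∧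
          ((openGraph (↑γ₁ : BondConfig V)).Reachable p' q' ∨ (openGraph (↑γ₂ : BondConfig V)).Reachable p' q')) →
        q' ∈ ({z | (openGraph (↑γ₁ : BondConfig V)).Reachable a z ∨
          ((openGraph (↑γ₁ : BondConfig V)).Reachable a u ∧ (openGraph (↑γ₂ : BondConfig V)).Reachable u v ∧
            (openGraph (↑γ₁ : BondConfig V)).Reachable v z) ∨
          ((openGraph (↑γ₁ : BondConfig V)).Reachable a v ∧ (openGraph (↑γ₂ : BondConfig V)).Reachable u v ∧
            (openGraph (↑γ₁ : BondConfig V)).Reachable u z)} : Set V) := by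
      rintro p' q' hp ⟨hp'S, hq'S, hr | hr⟩
      · rcases hp with h | ⟨h1, h2, h3⟩ | ⟨h1, h2, h3⟩
        · exact Or.inl (h.trans hr)
        · exact Or.inr (Or.inl ⟨h1, h2, h3.trans hr⟩)
        · exact Or.inr (Or.inr ⟨h1, h2, h3.trans hr⟩)
      · rcases eq_or_ne p' q' with hpq | hpq
        · rw [← hpq]; exact hp
        · obtain ⟨huv, hcase⟩ := key2 p' q' hp'S hq'S hr hpq
          rcases hcase with ⟨hp'u, hq'v⟩ | ⟨hp'v, hq'u⟩
          · rw [hp'u] at hp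
            rw [hq'v]
            rcases hp with h | ⟨h1, -, -⟩ | ⟨h1, -, -⟩
            · exact Or.inr (Or.inl ⟨h, huv, Reachable.refl _⟩)
            · exact Or.inr (Or.inl ⟨h1, huv, Reachable.refl _⟩)
            · exact Or.inl h1
          · rw [hp'v] at hp
            rw [hq'u]
            rcases hp with h | ⟨h1, -, -⟩ | ⟨h1, -, -⟩
            · exact Or.inr (Or.inr ⟨h, huv, Reachable.refl _⟩)
            · exact Or.inl h1
            · exact Or.inr (Or.inr ⟨h1, huv, Reachable.refl _⟩)
    -- the invariant holds at the end of the first one-sided segment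
    have hR0 : s' ∈ ({z | (openGraph (↑γ₁ : BondConfig V)).Reachable a z ∨
          ((openGraph (↑γ₁ : BondConfig V)).Reachable a u ∧ (openGraph (↑γ₂ : BondConfig V)).Reachable u v ∧
            (openGraph (↑γ₁ : BondConfig V)).Reachable v z) ∨
          ((openGraph (↑γ₁ : BondConfig V)).Reachable a v ∧ (openGraph (↑γ₂ : BondConfig V)).Reachable u v ∧
            (openGraph (↑γ₁ : BondConfig V)).Reachable u z)} : Set V) := by
      rcases hside with hs | hs
      · exact Or.inl hs
      · rcases eq_or_ne a s' with has | has
        · rw [← has]; exact Or.inl (Reachable.refl _)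
        · have ha2 : a ∈ V₂ := GZGluing.mem_of_reachable_ne h₂ hω₂ hs has
          have ha' : a ∈ ({u, v, b} : Set V) := by
            rcases ha ha2 with h | h
            · exact Or.inl h
            · exact Or.inr (Or.inl h)
          obtain ⟨huv, hcase⟩ := key2 a s' ha' hs'S hs has
          rcases hcase with ⟨hau, hsv⟩ | ⟨hav, hsu⟩
          · rw [hsv]
            exact Or.inr (Or.inl ⟨by rw [hau], huv, Reachable.refl _⟩)
          · rw [hsu]
            exact Or.inr (Or.inr ⟨by rw [hav], huv, Reachable.refl _⟩)
    exact GZGluing.reflTransGen_mem hA hchain hR0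
  · rintro (h | ⟨h1, h2, h3⟩ | ⟨h1, h2, h3⟩)
    · exact l₁ h
    · exact (l₁ h1).trans ((l₂ h2).trans (l₁ h3))
    · exact (l₁ h1).trans ((l₂ h2).symm.trans (l₁ h3))

/-- **The host pattern only sees the bit `1{u ↔ v in the piece}`**: two mark-free pieces attached along `{u, v}` whose
configurations agree on that bit give the same pattern on host marks `(x, y, s)`. [folklore] -/
theorem pat3_union_free_congr {E₂' : Finset (Sym2 V)} {V₂' : Set V} (h₁ : ∀ e ∈ (↑E₁ : Set (Sym2 V)), ∀ z ∈ e, z ∈ V₁)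
    (h₂ : ∀ e ∈ (↑E₂ : Set (Sym2 V)), ∀ z ∈ e, z ∈ V₂) (h₂' : ∀ e ∈ (↑E₂' : Set (Sym2 V)), ∀ z ∈ e, z ∈ V₂')
    (hS : V₁ ∩ V₂ ⊆ {u, v}) (hS' : V₁ ∩ V₂' ⊆ {u, v}) {x y s : V}
    (hx : x ∈ V₂ → x = u ∨ x = v) (hy : y ∈ V₂ → y = u ∨ y = v) (hs : s ∈ V₂ → s = u ∨ s = v)
    (hx' : x ∈ V₂' → x = u ∨ x = v) (hy' : y ∈ V₂' → y = u ∨ y = v) (hs' : s ∈ V₂' → s = u ∨ s = v)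
    {γ₁ γ₂ γ₂' : Finset (Sym2 V)} (g₁ : γ₁ ⊆ E₁) (g₂ : γ₂ ⊆ E₂) (g₂' : γ₂' ⊆ E₂')
    (hc : (openGraph (↑γ₂ : BondConfig V)).Reachable u v ↔ (openGraph (↑γ₂' : BondConfig V)).Reachable u v) :
    pat3 (γ₁ ∪ γ₂) x y s = pat3 (γ₁ ∪ γ₂') x y s := by
  refine pat3_eq_of_iff ?_ ?_ ?_
  · rw [reachable_union_free h₁ h₂ hS hx hy g₁ g₂, pat3_xy_iff, reachable_union_free h₁ h₂' hS' hx' hy' g₁ g₂', hc]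
  · rw [reachable_union_free h₁ h₂ hS hx hs g₁ g₂, pat3_xs_iff, reachable_union_free h₁ h₂' hS' hx' hs' g₁ g₂', hc]
  · rw [reachable_union_free h₁ h₂ hS hy hs g₁ g₂, pat3_ys_iff, reachable_union_free h₁ h₂' hS' hy' hs' g₁ g₂', hc]

/-- The one-edge piece `{uv}` lives on `{u, v}`. [folklore] -/
theorem edges_singleton_verts (u v : V) :
    ∀ e ∈ (↑({s(u, v)} : Finset (Sym2 V)) : Set (Sym2 V)), ∀ z ∈ e, z ∈ ({u, v} : Set V) := by
  intro e he z hz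
  rw [Finset.coe_singleton, Set.mem_singleton_iff] at he
  subst he
  rcases Sym2.mem_iff.1 hz with h | h
  · exact Or.inl h
  · exact Or.inr h

/-- **The piece may be replaced by the OPEN virtual edge `uv`** when `u ↔ v` in the piece: the host pattern of `γ₁ ∪ γ₂` is
that of `γ₁ + uv`. [folklore] -/
theorem pat3_union_free_of_reach (h₁ : ∀ e ∈ (↑E₁ : Set (Sym2 V)), ∀ z ∈ e, z ∈ V₁)
    (h₂ : ∀ e ∈ (↑E₂ : Set (Sym2 V)), ∀ z ∈ e, z ∈ V₂) (hS : V₁ ∩ V₂ ⊆ {u, v}) (huv : u ≠ v) {x y s : V}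
    (hx : x ∈ V₂ → x = u ∨ x = v) (hy : y ∈ V₂ → y = u ∨ y = v) (hs : s ∈ V₂ → s = u ∨ s = v)
    {γ₁ γ₂ : Finset (Sym2 V)} (g₁ : γ₁ ⊆ E₁) (g₂ : γ₂ ⊆ E₂) (hc : (openGraph (↑γ₂ : BondConfig V)).Reachable u v) :
    pat3 (γ₁ ∪ γ₂) x y s = pat3 (insert s(u, v) γ₁) x y s := by
  have hedge : (openGraph (↑({s(u, v)} : Finset (Sym2 V)) : BondConfig V)).Reachable u v := by
    refine SimpleGraph.Adj.reachable ((openGraph_adj _ u v).2 ⟨?_, huv⟩)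
    rw [Finset.coe_singleton]
    exact Set.mem_singleton _
  rw [Finset.insert_eq, Finset.union_comm {s(u, v)} γ₁]
  exact pat3_union_free_congr h₁ h₂ (edges_singleton_verts u v) hS (fun z hz => hz.2) hx hy hs (fun h => h) (fun h => h)
    (fun h => h) g₁ g₂ (subset_refl _) ⟨fun _ => hedge, fun _ => hc⟩

/-- **The piece may be DELETED** when `u ↮ v` in the piece: the host pattern of `γ₁ ∪ γ₂` is that of `γ₁`. [folklore] -/
theorem pat3_union_free_of_not_reach (h₁ : ∀ e ∈ (↑E₁ : Set (Sym2 V)), ∀ z ∈ e, z ∈ V₁)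
    (h₂ : ∀ e ∈ (↑E₂ : Set (Sym2 V)), ∀ z ∈ e, z ∈ V₂) (hS : V₁ ∩ V₂ ⊆ {u, v}) (huv : u ≠ v) {x y s : V}
    (hx : x ∈ V₂ → x = u ∨ x = v) (hy : y ∈ V₂ → y = u ∨ y = v) (hs : s ∈ V₂ → s = u ∨ s = v)
    {γ₁ γ₂ : Finset (Sym2 V)} (g₁ : γ₁ ⊆ E₁) (g₂ : γ₂ ⊆ E₂) (hc : ¬ (openGraph (↑γ₂ : BondConfig V)).Reachable u v) :
    pat3 (γ₁ ∪ γ₂) x y s = pat3 γ₁ x y s := by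
  have hempty : ¬ (openGraph (↑(∅ : Finset (Sym2 V)) : BondConfig V)).Reachable u v := by
    intro h
    have : openGraph (↑(∅ : Finset (Sym2 V)) : BondConfig V) = ⊥ := by rw [Finset.coe_empty, openGraph, fromEdgeSet_empty]
    rw [this, reachable_bot] at h
    exact huv h
  rw [← Finset.union_empty γ₁, Finset.union_assoc, Finset.empty_union]
  exact pat3_union_free_congr h₁ h₂ (edges_singleton_verts u v) hS (fun z hz => hz.2) hx hy hs (fun h => h) (fun h => h)
    (fun h => h) g₁ g₂ (Finset.empty_subset _) ⟨fun h => absurd h hc, fun h => absurd h hempty⟩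

end Reach

end FK

end Summit.CriticalPhenomena.PercolationContinuityZ3.Theorems
-- build-touch 2026-08-25T15:57:18Z T1-D (lead g18): re-land of p398262, declarations byte-identical
-- build-touch 2026-08-25T18:27Z T1-D (lead g18): re-land of p401927, declarations byte-identical
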